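import Mathlib.Probability.Distributions.Gaussian.Multivariate
import Mathlib.MeasureTheory.Function.SpecialFunctions.Inner
import Mathlib.MeasureTheory.Function.Floor
import Literature.Probability.Distributions.StdGaussianDensity
import Literature.Computability.Cryptography.StatisticalDistanceISupMeasure
import HarnessLib

/-!
# Statistical hiding of a shift by a spherical Gaussian; the rounded Gaussian on `ℤⁿ`

`Literature/Probability/Distributions/`. How well does a spherical Gaussian perturbation hide a
shift `v`? For `g ∼ N(0, I)` on a finite-dimensional real inner product space,
`Δ(N(0, σ²I), N(v, σ²I)) = 1 - 2·Pr[N(0,1) ≥ ‖v‖/(2σ)]`, so the shift is hidden with advantage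
`1/poly` exactly when `‖v‖/σ = O(√(log n))`. This file proves the (one-sided, factor-`2`-weaker)
bound that reductions use, and packages the perturbation law a Turing machine can (approximately)
sample — the coordinatewise ROUNDED Gaussian on `ℤⁿ` — with the two estimates such a use needs:
statistical hiding of integer shifts and an exponential norm tail. Written for the first component
of Peikert's classical `GapSVP → LWE` reduction (STOC 2009, Thm. 3.1, where the perturbation is
uniform in a ball and the hiding bound is the Goldreich–Goldwasser ball-overlap lemma, his Lemma 2.1;
a Gaussian serves equally, `Literature.Computability.Cryptography.PeikertReduction`), and generic.
Everything is PROVED from Mathlib's `ProbabilityTheory.stdGaussian` / `gaussianReal` and the tree's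
`stdGaussian_eq_withDensity`; all statements are [folklore].

## Results

* `stdGaussianDensity`, `stdGaussian_map_add_right_eq_withDensity` — the shifted standard Gaussian
  `N(u, I)` is `φ(x - u) dx`, `φ(x) = (2π)^{-d/2} e^{-‖x‖²/2}` (translation invariance of volume).
* `overlapHalfSpace u = {x | ‖u‖² ≤ 2⟪x, u⟫}` (where `φ(x - u) ≥ φ(x)`) and
  **`stdGaussian_real_sub_map_add_real_le`**: for every measurable `A`,
  `N(0,I)(A) - N(u,I)(A) ≤ 1 - N(0,I)(H_u)` (split `A` along `H_u`; pointwise density comparison on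
  `A ∩ H_u`, trivial bound on `A ∖ H_u`).
* `stdGaussian_overlapHalfSpace`: `N(0,I)(H_u) = Pr[N(0,1) ≥ ‖u‖/2]` (`u ≠ 0`; the law of `⟪e, x⟫`,
  `‖e‖ = 1`, is `N(0,1)`, Mathlib's `IsGaussian.map_eq_gaussianReal`, `variance_dual_stdGaussian`);
  `exp_le_gaussianReal_Ici`: `Pr[N(0,1) ≥ t] ≥ (2π)^{-1/2} e^{-(t+1)²/2}` (`t ≥ 0`).
* **`stdGaussian_smul_real_sub_shift_real_le`**: `Pr[σg ∈ A] - Pr[σg + v ∈ A] ≤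
  1 - Pr[N(0,1) ≥ ‖v‖/(2σ)]` for `σ > 0` (scaling).
* `roundVec`, `roundedGaussian n σ : PMF (Fin n → ℤ)` — the law `W_σ` of `round(σ g)`,
  `g ∼ N(0, Iₙ)` on `ℝⁿ` (via `Measure.toPMF`); **`tvDist_roundedGaussian_map_add_le`**,
  `…_one_sub_exp`: for `z ∈ ℤⁿ`, `Δ(W_σ, z + W_σ) ≤ 1 - Pr[N(0,1) ≥ ‖z‖/(2σ)] ≤
  1 - (2π)^{-1/2} e^{-(‖z‖/(2σ)+1)²/2}` (rounding commutes with integer shifts, `round⁻¹(S)` is an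
  event of `ℝⁿ`; the tree's `PMF.tvDist_eq_iSup_measure_holds`).
* `lintegral_exp_norm_sq_div_four_stdGaussian` (`E[e^{‖g‖²/4}] = 2^{d/2}`, Mathlib's
  `GaussianFourier.integral_rexp_neg_mul_sq_norm`), **`stdGaussian_real_norm_sq_ge_le`**
  (Chernoff: `Pr[‖g‖² ≥ t] ≤ 2^{d/2} e^{-t/4}`), `norm_roundVec_sub_le` (`‖round(x) - x‖ ≤ √n/2`),
  **`roundedGaussian_norm_gt_le`**: `Pr_{W_σ}[‖w‖ > σ√t + √n/2] ≤ 2^{n/2} e^{-t/4}`.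

## Design

* One-sided bounds only (`μ(A) - ν(A) ≤ …` for all `A` is what `Δ ≤ …` means for probability
  measures; the `PMF` statements use the tree's `PMF.tvDist`). The sharp constant (`1 - 2·Pr[…]`)
  is not needed by the hiding arguments downstream and is not proved.
* `ℤⁿ` is `Fin n → ℤ` with its product σ-algebra (all sets measurable); the integer vector `z` enters
  the bounds through any `zE : EuclideanSpace ℝ (Fin n)` with `zE i = z i` (e.g. the tree's
  `Literature.Algebra.EuclideanLattices.intVecToEuclidean n z`), so that this file does not import the
  lattice library.
* NOT here: samplers (a coin-driven approximate sampler for a 1-D rounded Gaussian is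
  `PseudoGaussianSampler.lean`), discrete Gaussians on lattices (`Algebra/EuclideanLattices/`).
-/

noncomputable section

open _root_.MeasureTheory _root_.ProbabilityTheory Set Real
open scoped ENNReal NNReal RealInnerProductSpace

namespace Literature.Probability.Distributions

variable {E : Type*} [NormedAddCommGroup E] [InnerProductSpace ℝ E] [FiniteDimensional ℝ E]
  [MeasurableSpace E] [BorelSpace E]

/-! ### The density and the shifted standard Gaussian -/

/-- The density `(2π)^{-d/2} e^{-‖x‖²/2}` of the standard Gaussian of `E` (`ℝ≥0∞`-valued), as in
`stdGaussian_eq_withDensity`. [folklore] -/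
def stdGaussianDensity (x : E) : ℝ≥0∞ :=
  ENNReal.ofReal ((2 * π) ^ (-(Module.finrank ℝ E : ℝ) / 2) * rexp (-‖x‖ ^ 2 / 2))

omit [FiniteDimensional ℝ E] [MeasurableSpace E] [BorelSpace E] in
/-- Unfolding of `stdGaussianDensity`. [folklore] -/
theorem stdGaussianDensity_apply (x : E) : stdGaussianDensity x =
    ENNReal.ofReal ((2 * π) ^ (-(Module.finrank ℝ E : ℝ) / 2) * rexp (-‖x‖ ^ 2 / 2)) := rfl

omit [FiniteDimensional ℝ E] in
/-- `stdGaussianDensity` is measurable. [folklore] -/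
theorem measurable_stdGaussianDensity : Measurable (stdGaussianDensity (E := E)) := by
  unfold stdGaussianDensity; fun_prop

omit [FiniteDimensional ℝ E] [MeasurableSpace E] [BorelSpace E] in
/-- The density is radially decreasing: `‖x‖ ≤ ‖y‖ ⇒ φ(y) ≤ φ(x)`. [folklore] -/
theorem stdGaussianDensity_anti {x y : E} (h : ‖x‖ ≤ ‖y‖) :
    stdGaussianDensity y ≤ stdGaussianDensity x := by
  unfold stdGaussianDensity
  refine ENNReal.ofReal_le_ofReal (mul_le_mul_of_nonneg_left ?_ (by positivity))
  rw [Real.exp_le_exp]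
  have : ‖x‖ ^ 2 ≤ ‖y‖ ^ 2 := pow_le_pow_left₀ (norm_nonneg _) h 2
  linarith

/-- `stdGaussian E = φ · dx`. [folklore] -/
theorem stdGaussian_eq_withDensity' :
    stdGaussian E = (volume : Measure E).withDensity stdGaussianDensity :=
  stdGaussian_eq_withDensity

/-- **The shifted standard Gaussian as a density**: the law of `x + u`, `x ∼ N(0, I)`, is
`φ(x - u) dx`. [folklore] -/
theorem stdGaussian_map_add_right_eq_withDensity (u : E) :
    (stdGaussian E).map (· + u) =
      (volume : Measure E).withDensity fun x => stdGaussianDensity (x - u) := by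
  rw [stdGaussian_eq_withDensity']
  have h := map_withDensity_of_measurePreserving (MeasurableEquiv.addRight u)
    (measurePreserving_add_right (volume : Measure E) u) (stdGaussianDensity (E := E))
  have hsymm : ∀ x : E, (MeasurableEquiv.addRight u).symm x = x - u := fun x => by
    apply (MeasurableEquiv.addRight u).injective
    rw [MeasurableEquiv.apply_symm_apply]
    simp [MeasurableEquiv.coe_addRight]
  have hcoe : ((· + u) : E → E) = (MeasurableEquiv.addRight u) := by
    funext x; simp [MeasurableEquiv.coe_addRight]
  rw [hcoe, h]
  congr 1
  funext x
  simp only [Function.comp_apply, hsymm]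

/-! ### The hiding inequality -/

/-- The *overlap half-space* of the shift `u`: `H_u = {x | ‖u‖² ≤ 2⟪x, u⟫} = {x | ‖x - u‖ ≤ ‖x‖}`,
where the shifted density dominates the centred one. [folklore] -/
def overlapHalfSpace (u : E) : Set E := {x | ‖u‖ ^ 2 ≤ 2 * ⟪x, u⟫}

omit [FiniteDimensional ℝ E] [MeasurableSpace E] [BorelSpace E] in
/-- Membership in the overlap half-space. [folklore] -/
theorem mem_overlapHalfSpace {u x : E} : x ∈ overlapHalfSpace u ↔ ‖u‖ ^ 2 ≤ 2 * ⟪x, u⟫ := Iff.rfl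

omit [FiniteDimensional ℝ E] [MeasurableSpace E] [BorelSpace E] in
/-- On the overlap half-space, `‖x - u‖ ≤ ‖x‖`. [folklore] -/
theorem norm_sub_le_norm_of_mem_overlapHalfSpace {u x : E} (hx : x ∈ overlapHalfSpace u) :
    ‖x - u‖ ≤ ‖x‖ := by
  rw [mem_overlapHalfSpace] at hx
  have h : ‖x - u‖ ^ 2 ≤ ‖x‖ ^ 2 := by
    rw [@norm_sub_sq_real]
    linarith
  exact le_of_sq_le_sq (by simpa [sq] using h) (norm_nonneg _)

/-- The overlap half-space is measurable (a closed set). [folklore] -/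
theorem measurableSet_overlapHalfSpace (u : E) : MeasurableSet (overlapHalfSpace u) :=
  measurableSet_le measurable_const ((Measurable.inner measurable_id measurable_const).const_mul 2)

/-- **Statistical hiding of a shift by the standard Gaussian.** For every shift `u` and every
measurable event `A`: `N(0,I)(A) - N(u,I)(A) ≤ 1 - N(0,I)(H_u)` where
`H_u = {x | ‖u‖² ≤ 2⟪x, u⟫}` is the half-space on which the shifted density dominates; hence
`Δ(N(0,I), N(u,I)) ≤ 1 - N(0,I)(H_u) = 1 - Pr[N(0,1) ≥ ‖u‖/2]`. (The exact value is
`1 - 2 Pr[N(0,1) ≥ ‖u‖/2]`; the factor `2` is not needed downstream.) Proof: split `A` along `H_u`;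
on `A ∩ H_u` the centred mass is at most the shifted mass (pointwise comparison of densities,
`‖x - u‖ ≤ ‖x‖`), and `A ∖ H_u` has centred mass at most `1 - N(0,I)(H_u)`. [folklore] -/
theorem stdGaussian_real_sub_map_add_real_le (u : E) {A : Set E} (hA : MeasurableSet A) :
    (stdGaussian E).real A - ((stdGaussian E).map (· + u)).real A ≤
      1 - (stdGaussian E).real (overlapHalfSpace u) := by
  set γ : Measure E := stdGaussian E with hγ
  set γu : Measure E := (stdGaussian E).map (· + u) with hγu
  haveI : IsProbabilityMeasure γu :=
    Measure.isProbabilityMeasure_map (Measurable.aemeasurable (by fun_prop))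
  have hH := measurableSet_overlapHalfSpace u
  -- on `A ∩ H_u` the centred mass is dominated by the shifted mass
  have hdom : γ (A ∩ overlapHalfSpace u) ≤ γu (A ∩ overlapHalfSpace u) := by
    rw [hγu, stdGaussian_map_add_right_eq_withDensity, hγ, stdGaussian_eq_withDensity',
      withDensity_apply _ (hA.inter hH), withDensity_apply _ (hA.inter hH)]
    refine setLIntegral_mono (measurable_stdGaussianDensity.comp (measurable_id.sub_const u)) ?_
    intro x hx
    exact stdGaussianDensity_anti (norm_sub_le_norm_of_mem_overlapHalfSpace hx.2)
  have hdom' : γ.real (A ∩ overlapHalfSpace u) ≤ γu.real (A ∩ overlapHalfSpace u) :=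
    ENNReal.toReal_mono (measure_ne_top _ _) hdom
  have hsplit : γ.real A = γ.real (A ∩ overlapHalfSpace u) + γ.real (A \ overlapHalfSpace u) :=
    (measureReal_inter_add_sdiff hH (measure_ne_top _ _)).symm
  have hmono : γu.real (A ∩ overlapHalfSpace u) ≤ γu.real A :=
    measureReal_mono Set.inter_subset_left (measure_ne_top _ _)
  have hrest : γ.real (A \ overlapHalfSpace u) ≤ 1 - γ.real (overlapHalfSpace u) := by
    rw [← probReal_compl_eq_one_sub hH]
    exact measureReal_mono (fun x hx => hx.2) (measure_ne_top _ _)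
  linarith

/-- The Gaussian mass of the overlap half-space of `u ≠ 0` is the one-dimensional tail
`Pr[N(0,1) ≥ ‖u‖/2]`: the law of `⟪e, x⟫`, `e = u/‖u‖`, under `N(0, I)` is `N(0, 1)` (Mathlib's
`IsGaussian.map_eq_gaussianReal` with `variance_dual_stdGaussian`). [folklore] -/
theorem stdGaussian_overlapHalfSpace {u : E} (hu : u ≠ 0) :
    stdGaussian E (overlapHalfSpace u) = gaussianReal 0 1 (Ici (‖u‖ / 2)) := by
  set e : E := (‖u‖)⁻¹ • u with he_def
  have he : ‖e‖ = 1 := norm_smul_inv_norm hu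
  have hupos : 0 < ‖u‖ := norm_pos_iff.2 hu
  have hset : overlapHalfSpace u = (innerSL ℝ e) ⁻¹' Ici (‖u‖ / 2) := by
    ext x
    rw [mem_overlapHalfSpace, Set.mem_preimage, Set.mem_Ici, innerSL_apply_apply, he_def,
      real_inner_smul_left, real_inner_comm x u, inv_mul_eq_div, le_div_iff₀ hupos]
    constructor <;> intro h <;> nlinarith
  have hL : Measurable (innerSL ℝ e) := (innerSL ℝ e).continuous.measurable
  rw [hset, ← Measure.map_apply hL measurableSet_Ici, IsGaussian.map_eq_gaussianReal (innerSL ℝ e),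
    integral_strongDual_stdGaussian, variance_dual_stdGaussian, innerSL_apply_norm, he]
  norm_num

/-- **A crude Gaussian tail lower bound**: for `t ≥ 0`,
`Pr[N(0,1) ≥ t] ≥ (2π)^{-1/2} e^{-(t+1)²/2}` (the mass of `[t, t+1]`, where the density is at least
its value at `t + 1`). [folklore] -/
theorem exp_le_gaussianReal_Ici {t : ℝ} (ht : 0 ≤ t) :
    ENNReal.ofReal ((Real.sqrt (2 * π))⁻¹ * rexp (-(t + 1) ^ 2 / 2)) ≤ gaussianReal 0 1 (Ici t) := by
  rw [gaussianReal_apply 0 one_ne_zero]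
  set c : ℝ≥0∞ := ENNReal.ofReal ((Real.sqrt (2 * π))⁻¹ * rexp (-(t + 1) ^ 2 / 2)) with hc
  calc c = c * volume (Icc t (t + 1)) := by
          rw [Real.volume_Icc, show t + 1 - t = 1 by ring, ENNReal.ofReal_one, mul_one]
    _ = ∫⁻ _ in Icc t (t + 1), c := (setLIntegral_const _ _).symm
    _ ≤ ∫⁻ x in Icc t (t + 1), gaussianPDF 0 1 x := by
          refine setLIntegral_mono (measurable_gaussianPDF 0 1) fun x hx => ?_
          rw [hc, gaussianPDF, gaussianPDFReal_def]
          refine ENNReal.ofReal_le_ofReal ?_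
          simp only [NNReal.coe_one, mul_one, sub_zero]
          refine mul_le_mul_of_nonneg_left (Real.exp_le_exp.2 ?_) (by positivity)
          have h1 : x ^ 2 ≤ (t + 1) ^ 2 := pow_le_pow_left₀ (ht.trans hx.1) hx.2 2
          linarith
    _ ≤ ∫⁻ x in Ici t, gaussianPDF 0 1 x := lintegral_mono_set Icc_subset_Ici_self

/-- **Statistical hiding of a shift by a spherical Gaussian of width `σ`**: for `σ > 0`, every
shift `v` and every measurable `A`,
`Pr[σg ∈ A] - Pr[σg + v ∈ A] ≤ 1 - Pr[N(0,1) ≥ ‖v‖/(2σ)]` (`g ∼ N(0, I)`), i.e.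
`Δ(N(0, σ²I), N(v, σ²I)) ≤ 1 - Pr[N(0,1) ≥ ‖v‖/(2σ)]`. [folklore] -/
theorem stdGaussian_smul_real_sub_shift_real_le {σ : ℝ} (hσ : 0 < σ) (v : E) {A : Set E}
    (hA : MeasurableSet A) :
    ((stdGaussian E).map (σ • ·)).real A - ((stdGaussian E).map fun x => σ • x + v).real A ≤
      1 - (gaussianReal 0 1 (Ici (‖v‖ / (2 * σ)))).toReal := by
  have hsm : Measurable fun x : E => σ • x := measurable_id.const_smul σ
  have hadd : Measurable fun x : E => x + σ⁻¹ • v := measurable_id.add_const _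
  set u : E := σ⁻¹ • v with hu
  have hcomp : (fun x : E => σ • x + v) = (fun x : E => σ • x) ∘ fun x : E => x + u := by
    funext x
    simp only [Function.comp_apply, smul_add, hu, smul_smul, mul_inv_cancel₀ hσ.ne', one_smul]
  rw [hcomp, ← Measure.map_map hsm hadd, measureReal_def, measureReal_def,
    Measure.map_apply hsm hA, Measure.map_apply hsm hA, ← measureReal_def, ← measureReal_def]
  refine (stdGaussian_real_sub_map_add_real_le u (hsm hA)).trans ?_
  -- `1 - γ(H_u) ≤ 1 - Pr[N(0,1) ≥ ‖v‖/(2σ)]`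
  by_cases hv : v = 0
  · subst hv
    have hu0 : u = 0 := by simp [hu]
    have hH : overlapHalfSpace u = Set.univ := by
      ext x; simp [mem_overlapHalfSpace, hu0]
    rw [hH, probReal_univ]
    have h1 : (gaussianReal 0 1 (Ici (‖(0 : E)‖ / (2 * σ)))).toReal ≤ 1 :=
      ENNReal.toReal_le_of_le_ofReal zero_le_one (by rw [ENNReal.ofReal_one]; exact prob_le_one)
    linarith
  · have hu0 : u ≠ 0 := by
      simp only [hu, ne_eq, smul_eq_zero, inv_eq_zero, hσ.ne', hv, or_self, not_false_eq_true]
    have hnorm : ‖u‖ / 2 = ‖v‖ / (2 * σ) := by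
      rw [hu, norm_smul, norm_inv, Real.norm_of_nonneg hσ.le]
      field_simp
    rw [measureReal_def, stdGaussian_overlapHalfSpace hu0, hnorm]

/-! ### The rounded Gaussian on `ℤⁿ` hides short integer shifts -/

section Rounded

variable (n : ℕ)

/-- Coordinatewise rounding `ℝⁿ → ℤⁿ` (nearest integer, ties up: Mathlib's `round`). [folklore] -/
def roundVec (x : EuclideanSpace ℝ (Fin n)) : Fin n → ℤ := fun i => round (x i)

/-- Unfolding of `roundVec`. [folklore] -/
@[simp] theorem roundVec_apply (x : EuclideanSpace ℝ (Fin n)) (i : Fin n) : roundVec n x i = round (x i) :=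
  rfl

/-- Rounding commutes with integer shifts: `round(x + z) = round(x) + z` for `z ∈ ℤⁿ`. [folklore] -/
theorem roundVec_add_of_int (x zE : EuclideanSpace ℝ (Fin n)) (z : Fin n → ℤ) (hz : ∀ i, zE i = z i) :
    roundVec n (x + zE) = z + roundVec n x := by
  funext i
  simp only [roundVec_apply, PiLp.add_apply, hz, Pi.add_apply, round_add_intCast]
  ring

/-- `roundVec` is measurable. [folklore] -/
theorem measurable_roundVec : Measurable (roundVec n) := by
  refine measurable_pi_lambda _ fun i => ?_
  have hcoord : Measurable fun x : EuclideanSpace ℝ (Fin n) => x i :=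
    (EuclideanSpace.proj (𝕜 := ℝ) i).continuous.measurable
  have h : (fun x : EuclideanSpace ℝ (Fin n) => roundVec n x i) = fun x => ⌊x i + 1 / 2⌋ := by
    funext x; exact round_eq (x i)
  rw [h]
  exact Measurable.comp Int.measurable_floor (hcoord.add_const _)

/-- The law of `round(σ g)`, `g ∼ N(0, Iₙ)`, as a measure on `ℤⁿ`. [folklore] -/
def roundedGaussianMeasure (σ : ℝ) : Measure (Fin n → ℤ) :=
  (((stdGaussian (EuclideanSpace ℝ (Fin n))).map (σ • ·)).map (roundVec n))

/-- The rounded Gaussian law is a probability measure. [folklore] -/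
instance isProbabilityMeasure_roundedGaussianMeasure (σ : ℝ) :
    IsProbabilityMeasure (roundedGaussianMeasure n σ) := by
  haveI : IsProbabilityMeasure ((stdGaussian (EuclideanSpace ℝ (Fin n))).map (σ • ·)) :=
    Measure.isProbabilityMeasure_map (measurable_id.const_smul σ).aemeasurable
  exact Measure.isProbabilityMeasure_map (measurable_roundVec n).aemeasurable

/-- **The rounded Gaussian** `W_σ` on `ℤⁿ`: the law of `round(σ g)`, `g ∼ N(0, Iₙ)` standard Gaussian
of `ℝⁿ`, as a `PMF` (a perturbation law of `ℓ₂`-width about `σ√n`, supported on the integer grid).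
[folklore] -/
def roundedGaussian (σ : ℝ) : PMF (Fin n → ℤ) :=
  (roundedGaussianMeasure n σ).toPMF

/-- The mass the rounded Gaussian gives to a set is its measure. [folklore] -/
theorem toOuterMeasure_roundedGaussian (σ : ℝ) (S : Set (Fin n → ℤ)) :
    (roundedGaussian n σ).toOuterMeasure S = roundedGaussianMeasure n σ S := by
  rw [← PMF.toMeasure_apply_eq_toOuterMeasure, roundedGaussian, Measure.toPMF_toMeasure]

/-- **The rounded Gaussian statistically hides short integer shifts**: for `σ > 0` and `z ∈ ℤⁿ`,
`Δ(W_σ, z + W_σ) ≤ 1 - Pr[N(0,1) ≥ ‖z‖/(2σ)]`. Rounding commutes with integer shifts, so this is the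
continuous bound `stdGaussian_smul_real_sub_shift_real_le` read on the events `round⁻¹(S)`
(data processing). (`zE` is `z` viewed in `ℝⁿ`.) [folklore] -/
theorem tvDist_roundedGaussian_map_add_le {σ : ℝ} (hσ : 0 < σ) (z : Fin n → ℤ)
    (zE : EuclideanSpace ℝ (Fin n)) (hz : ∀ i, zE i = z i) :
    (roundedGaussian n σ).tvDist ((roundedGaussian n σ).map (z + ·)) ≤
      1 - (gaussianReal 0 1 (Ici (‖zE‖ / (2 * σ)))).toReal := by
  rw [PMF.tvDist_eq_iSup_measure_holds]
  refine ciSup_le fun S => ?_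
  have hS : MeasurableSet S := S.to_countable.measurableSet
  have hsm : Measurable fun x : EuclideanSpace ℝ (Fin n) => σ • x := measurable_id.const_smul σ
  have hadd : Measurable fun x : EuclideanSpace ℝ (Fin n) => x + zE := measurable_id.add_const _
  have hA : MeasurableSet (roundVec n ⁻¹' S) := measurable_roundVec n hS
  have hS' : MeasurableSet ((z + ·) ⁻¹' S) := Set.Countable.measurableSet (Set.to_countable _)
  rw [PMF.toOuterMeasure_map_apply, toOuterMeasure_roundedGaussian, toOuterMeasure_roundedGaussian,
    roundedGaussianMeasure, Measure.map_apply (measurable_roundVec n) hS,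
    Measure.map_apply (measurable_roundVec n) hS']
  have hpre : roundVec n ⁻¹' ((z + ·) ⁻¹' S) = (· + zE) ⁻¹' (roundVec n ⁻¹' S) := by
    ext x
    simp only [Set.mem_preimage, roundVec_add_of_int n x zE z hz]
  rw [hpre, ← Measure.map_apply hadd hA, Measure.map_map hadd hsm]
  exact stdGaussian_smul_real_sub_shift_real_le hσ zE hA

/-- The same bound with the explicit tail estimate: for `σ > 0` and `z ∈ ℤⁿ`,
`Δ(W_σ, z + W_σ) ≤ 1 - (2π)^{-1/2} exp(-(‖z‖/(2σ) + 1)²/2)`; in particular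
`Δ ≤ 1 - 1/poly(n)` as soon as `‖z‖/σ = O(√(log n))`. [folklore] -/
theorem tvDist_roundedGaussian_map_add_le_one_sub_exp {σ : ℝ} (hσ : 0 < σ) (z : Fin n → ℤ)
    (zE : EuclideanSpace ℝ (Fin n)) (hz : ∀ i, zE i = z i) :
    (roundedGaussian n σ).tvDist ((roundedGaussian n σ).map (z + ·)) ≤
      1 - (Real.sqrt (2 * π))⁻¹ * rexp (-(‖zE‖ / (2 * σ) + 1) ^ 2 / 2) := by
  refine (tvDist_roundedGaussian_map_add_le n hσ z zE hz).trans ?_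
  have ht : 0 ≤ ‖zE‖ / (2 * σ) := by positivity
  have h := exp_le_gaussianReal_Ici ht
  have h' : (Real.sqrt (2 * π))⁻¹ * rexp (-(‖zE‖ / (2 * σ) + 1) ^ 2 / 2) ≤
      (gaussianReal 0 1 (Ici (‖zE‖ / (2 * σ)))).toReal := by
    rw [← ENNReal.ofReal_le_iff_le_toReal (measure_ne_top _ _)]
    exact h
  linarith

end Rounded

/-! ### Norm tail of the standard Gaussian (Chernoff) -/

/-- **Exponential moment of the squared norm**: `E[e^{‖g‖²/4}] = 2^{d/2}` for `g ∼ N(0, I_d)`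
(`∫ (2π)^{-d/2} e^{-‖x‖²/4} dx = (2π)^{-d/2} (4π)^{d/2}`, Mathlib's
`GaussianFourier.integral_rexp_neg_mul_sq_norm`). [folklore] -/
theorem lintegral_exp_norm_sq_div_four_stdGaussian :
    ∫⁻ x, ENNReal.ofReal (rexp (‖x‖ ^ 2 / 4)) ∂(stdGaussian E) =
      ENNReal.ofReal ((2 : ℝ) ^ ((Module.finrank ℝ E : ℝ) / 2)) := by
  set d : ℕ := Module.finrank ℝ E with hd
  rw [lintegral_stdGaussian_eq_lintegral_mul (by fun_prop), ← hd]
  have hpt : ∀ x : E, ENNReal.ofReal ((2 * π) ^ (-(d : ℝ) / 2) * rexp (-‖x‖ ^ 2 / 2)) *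
      ENNReal.ofReal (rexp (‖x‖ ^ 2 / 4)) =
        ENNReal.ofReal ((2 * π) ^ (-(d : ℝ) / 2) * rexp (-(1 / 4) * ‖x‖ ^ 2)) := fun x => by
    rw [← ENNReal.ofReal_mul (by positivity), mul_assoc, ← Real.exp_add]
    congr 2; ring_nf
  simp_rw [hpt]
  -- real Gaussians are integrable (norm of Mathlib's complex Gaussian integrand)
  have hgauss : Integrable fun x : E => rexp (-(1 / 4) * ‖x‖ ^ 2) := by
    have h := (GaussianFourier.integrable_cexp_neg_mul_sq_norm_add (V := E) (b := ((1 / 4 : ℝ) : ℂ))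
      (by norm_num) 0 0).norm
    refine h.congr (Filter.Eventually.of_forall fun v => ?_)
    simp only [zero_mul, add_zero, Complex.norm_exp]
    congr 1
    have : -((1 / 4 : ℝ) : ℂ) * (‖v‖ : ℂ) ^ 2 = ((-(1 / 4) * ‖v‖ ^ 2 : ℝ) : ℂ) := by push_cast; ring
    rw [this, Complex.ofReal_re]
  have hint : Integrable fun x : E => (2 * π) ^ (-(d : ℝ) / 2) * rexp (-(1 / 4) * ‖x‖ ^ 2) :=
    hgauss.const_mul _
  rw [← ofReal_integral_eq_lintegral_ofReal hint (Filter.Eventually.of_forall fun x => by positivity),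
    integral_const_mul, GaussianFourier.integral_rexp_neg_mul_sq_norm (by norm_num : (0 : ℝ) < 1 / 4)]
  congr 1
  have h4 : (2 * (2 * π)) ^ ((d : ℝ) / 2) = (2 : ℝ) ^ ((d : ℝ) / 2) * (2 * π) ^ ((d : ℝ) / 2) :=
    Real.mul_rpow (by norm_num) (by positivity)
  rw [← hd, show π / (1 / 4) = 2 * (2 * π) by ring, h4]
  calc (2 * π) ^ (-(d : ℝ) / 2) * ((2 : ℝ) ^ ((d : ℝ) / 2) * (2 * π) ^ ((d : ℝ) / 2))
      = (2 : ℝ) ^ ((d : ℝ) / 2) * ((2 * π) ^ (-(d : ℝ) / 2) * (2 * π) ^ ((d : ℝ) / 2)) := by ring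
    _ = (2 : ℝ) ^ ((d : ℝ) / 2) := by
        rw [← Real.rpow_add (by positivity), show -(d : ℝ) / 2 + (d : ℝ) / 2 = 0 by ring,
          Real.rpow_zero, mul_one]

/-- **Chernoff bound for the squared norm**: `Pr[‖g‖² ≥ t] ≤ 2^{d/2} e^{-t/4}` for `g ∼ N(0, I_d)`
(Markov's inequality applied to `e^{‖g‖²/4}`); e.g. `Pr[‖g‖² ≥ 4d] ≤ (√2/e)^d`,
`Pr[‖g‖ ≥ 2√d + s] ≤ e^{-s²/4}`. [folklore] -/
theorem stdGaussian_real_norm_sq_ge_le (t : ℝ) :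
    (stdGaussian E).real {x | t ≤ ‖x‖ ^ 2} ≤
      (2 : ℝ) ^ ((Module.finrank ℝ E : ℝ) / 2) * rexp (-t / 4) := by
  set d : ℕ := Module.finrank ℝ E with hd
  have hf : AEMeasurable (fun x : E => ENNReal.ofReal (rexp (‖x‖ ^ 2 / 4))) (stdGaussian E) :=
    (by fun_prop : Measurable fun x : E => ENNReal.ofReal (rexp (‖x‖ ^ 2 / 4))).aemeasurable
  have hM := mul_meas_ge_le_lintegral₀ hf (ENNReal.ofReal (rexp (t / 4)))
  rw [lintegral_exp_norm_sq_div_four_stdGaussian] at hM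
  have hset : {x : E | t ≤ ‖x‖ ^ 2} ⊆
      {x : E | ENNReal.ofReal (rexp (t / 4)) ≤ ENNReal.ofReal (rexp (‖x‖ ^ 2 / 4))} := by
    intro x hx
    exact ENNReal.ofReal_le_ofReal (Real.exp_le_exp.2 (by simp only [Set.mem_setOf_eq] at hx; linarith))
  have hpos : ENNReal.ofReal (rexp (t / 4)) ≠ 0 := by
    rw [ne_eq, ENNReal.ofReal_eq_zero, not_le]; exact Real.exp_pos _
  have h1 : (stdGaussian E) {x : E | t ≤ ‖x‖ ^ 2} ≤
      ENNReal.ofReal ((2 : ℝ) ^ ((d : ℝ) / 2)) / ENNReal.ofReal (rexp (t / 4)) := by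
    rw [ENNReal.le_div_iff_mul_le (Or.inl hpos) (Or.inl ENNReal.ofReal_ne_top), mul_comm]
    exact (mul_le_mul' le_rfl (measure_mono hset)).trans hM
  rw [measureReal_def]
  refine (ENNReal.toReal_mono ?_ h1).trans ?_
  · exact ENNReal.div_ne_top ENNReal.ofReal_ne_top hpos
  · rw [ENNReal.toReal_div, ENNReal.toReal_ofReal (by positivity), ENNReal.toReal_ofReal (by positivity),
      div_eq_mul_inv, ← Real.exp_neg]
    ring_nf
    rfl

section RoundedTail

variable (n : ℕ)

/-- Rounding moves a vector of `ℝⁿ` by at most `√n/2` in norm. [folklore] -/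
theorem norm_roundVec_sub_le (x : EuclideanSpace ℝ (Fin n)) :
    ‖(WithLp.toLp 2 fun i => (roundVec n x i : ℝ) : EuclideanSpace ℝ (Fin n)) - x‖ ≤ Real.sqrt n / 2 := by
  rw [EuclideanSpace.norm_eq]
  have hcoord : ∀ i : Fin n,
      ‖((WithLp.toLp 2 fun i => (roundVec n x i : ℝ) : EuclideanSpace ℝ (Fin n)) - x) i‖ ^ 2 ≤ (1 / 2) ^ 2 := by
    intro i
    refine pow_le_pow_left₀ (norm_nonneg _) ?_ 2
    simp only [PiLp.sub_apply, roundVec_apply, Real.norm_eq_abs]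
    rw [abs_sub_comm]
    exact abs_sub_round (x i)
  calc Real.sqrt (∑ i, ‖((WithLp.toLp 2 fun i => (roundVec n x i : ℝ) : EuclideanSpace ℝ (Fin n)) - x) i‖ ^ 2)
      ≤ Real.sqrt (∑ _i : Fin n, (1 / 2 : ℝ) ^ 2) := Real.sqrt_le_sqrt (Finset.sum_le_sum fun i _ => hcoord i)
    _ = Real.sqrt n / 2 := by
        rw [Finset.sum_const, Finset.card_univ, Fintype.card_fin, nsmul_eq_mul,
          Real.sqrt_mul' _ (by positivity), Real.sqrt_sq (by norm_num)]
        ring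

/-- **Norm tail of the rounded Gaussian**: for `σ > 0` and real `t`,
`Pr_{w ∼ W_σ}[‖w‖ > σ√t + √n/2] ≤ 2^{n/2} e^{-t/4}`; e.g. with `t = 4n + 4s`,
`Pr[‖w‖ > 2σ√(n + s) + √n/2] ≤ e^{-s}`. [folklore] -/
theorem roundedGaussian_norm_gt_le {σ : ℝ} (hσ : 0 < σ) (t : ℝ) :
    ((roundedGaussian n σ).toOuterMeasure
        {w | σ * Real.sqrt t + Real.sqrt n / 2 <
          ‖(WithLp.toLp 2 fun i => (w i : ℝ) : EuclideanSpace ℝ (Fin n))‖}).toReal ≤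
      (2 : ℝ) ^ ((n : ℝ) / 2) * rexp (-t / 4) := by
  set T : Set (Fin n → ℤ) := {w | σ * Real.sqrt t + Real.sqrt n / 2 <
      ‖(WithLp.toLp 2 fun i => (w i : ℝ) : EuclideanSpace ℝ (Fin n))‖} with hT
  have hS : MeasurableSet T := T.to_countable.measurableSet
  have hsm : Measurable fun x : EuclideanSpace ℝ (Fin n) => σ • x := measurable_id.const_smul σ
  rw [toOuterMeasure_roundedGaussian, roundedGaussianMeasure, Measure.map_apply (measurable_roundVec n) hS,
    Measure.map_apply hsm (measurable_roundVec n hS), ← measureReal_def]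
  -- the event forces `‖x‖² ≥ t` for the underlying Gaussian vector
  have hsub : (fun x : EuclideanSpace ℝ (Fin n) => σ • x) ⁻¹' (roundVec n ⁻¹' T) ⊆
      {x : EuclideanSpace ℝ (Fin n) | t ≤ ‖x‖ ^ 2} := by
    intro x hx
    simp only [Set.mem_preimage, hT, Set.mem_setOf_eq] at hx
    simp only [Set.mem_setOf_eq]
    have htri : ‖(WithLp.toLp 2 fun i => (roundVec n (σ • x) i : ℝ) : EuclideanSpace ℝ (Fin n))‖ ≤
        ‖σ • x‖ + Real.sqrt n / 2 := by
      have := norm_roundVec_sub_le n (σ • x)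
      calc ‖(WithLp.toLp 2 fun i => (roundVec n (σ • x) i : ℝ) : EuclideanSpace ℝ (Fin n))‖
          = ‖((WithLp.toLp 2 fun i => (roundVec n (σ • x) i : ℝ) : EuclideanSpace ℝ (Fin n)) - σ • x) +
              σ • x‖ := by rw [sub_add_cancel]
        _ ≤ _ := (norm_add_le _ _).trans (by linarith)
    have hσx : σ * Real.sqrt t < ‖σ • x‖ := by linarith
    rw [norm_smul, Real.norm_of_nonneg hσ.le] at hσx
    have hxt : Real.sqrt t < ‖x‖ := lt_of_mul_lt_mul_left hσx hσ.le
    have := (Real.sqrt_lt' (lt_of_le_of_lt (Real.sqrt_nonneg t) hxt)).1 hxt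
    linarith
  refine (measureReal_mono hsub (measure_ne_top _ _)).trans ?_
  have h := stdGaussian_real_norm_sq_ge_le (E := EuclideanSpace ℝ (Fin n)) t
  rwa [finrank_euclideanSpace_fin] at h

end RoundedTail

end Literature.Probability.Distributions

end
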